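/-
Copyright (c) 2026. All rights reserved.
Released under Apache 2.0 license as described in the file LICENSE.
Authors: abc-iut cell, seat abc-iut-w6-d075 (gen 3; proof-only sequel of abc-iut-w6-d071's
`AbsTopIAlmostProSigmaBridge.lean`: the two packaged closers left out there).
-/
import Literature.AnabelianGeometry.AbsoluteAnabelian.AbsTopIAlmostProSigmaBridge
import Literature.AnabelianGeometry.AbsoluteAnabelian.AbsTopIThm26iProSigmaProofs
import Literature.AnabelianGeometry.AbsoluteAnabelian.AbsTopIThm26iiStarProofs
import Literature.AnabelianGeometry.AbsoluteAnabelian.AbsTopILem27iiiBridges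
import HarnessLib

/-!
# [AbsTopI] Thm 2.6 (i) and Thm 2.6 (ii) [(∗)-route] packaged over a Δ that is only ALMOST pro-`Σ`

S. Mochizuki, *Topics in Absolute Anabelian Geometry I: Generalities* (2012) [AbsTopI] (lit key
`paper:url-11ac98ba15fc`): Def 1.1 (iii) p. 10 ("if `G` admits an open subgroup which is pro-`Σ`, then we
shall say that `G` is almost pro-`Σ` … any almost pro-`Σ`-maximal quotient of `G` is almost pro-`Σ`"),
Def 2.1 (i)/(ii) p. 17 ("[almost pro-`Σ`] GFG-type", "[geometrically almost pro-`Σ`] AFG-type"), Thm 2.6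
(i)/(ii) p. 21.

PROOF-ONLY sequel (no definition, no named fact) of abc-iut-w6-d071's `AbsTopIAlmostProSigmaBridge.lean`
(abc-iut row «THM26-ALMOST-PROSIGMA»), which re-keys the §2 closers from `IsProSet E.geom S` ("`Δ` pro-`Σ`")
to print's `IsAlmostPro E.geom S` through the mechanisms (M1) `IsAlmostPro.apply_padicInt_eq_one` and (M3)
`FundamentalExtension.isAlmostPro_geom_inf_of_isOpen`.  Two PACKAGED closers were left out there and are
supplied here (abc-iut-w6-d075's count-deciding read of p444875, INFO-1/INFO-2), each a one-line
substitution in the landed pro-`Σ` closer: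

* `FundamentalExtension.thm26i_of_isFreeProcyclic_of_isAlmostPro` — **Thm 2.6 (i) AS TYPED (`E.Thm26i`)
  for `G ≅ Ẑ` and `Δ` ALMOST pro-`Σ`**, twin of `thm26i_of_isFreeProcyclic_of_isProSet`: the Tate input
  ("`T_l(A)/G = 0`") is needed at the primes `l ∈ Σ` only, the `H`-invariant characters `Δ ∩ H → ℤ_l`
  for `l ∉ Σ` being trivial by (M1)+(M3);
* `FundamentalExtension.thm26ii_of_starCondition_of_isAlmostPro` (and `…_of_localEPC`) — **Thm 2.6 (ii)
  AS TYPED (`E.Thm26ii B S`) on the (∗)-route for `Δ` ALMOST pro-`Σ`**, twin of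
  `thm26ii_of_starCondition_of_isProSet`: the rank identity with ONE `m` comes from the splitting and
  condition (∗) (`exists_freeProlRank_arith_eq_gal_add`), the off-`Σ` clause from
  `thm26ii_of_isAlmostPro_of_rank`.  (HONEST SCOPE as for the pro-`Σ` sibling: for `Σ ≠ 𝔓𝔯𝔦𝔪𝔢𝔰` the
  two inputs force `m = 0`; the (∗)_Σ closer `thm26ii_of_sigmaStarCondition_of_geomTFG` carries no
  pro-`Σ` binder at all.)

* `MLFBase.exists_open_rankExcess_of_two_le_encard_of_offSigma` / `…_of_isAlmostPro` — abc-iut-w6-d034's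
  rank-excess reduction of Thm 2.6 (iii) clause two (proof p. 23 l. 36–41: "there exists some open subgroup
  `H ⊆ Π` and some `l` with `δ¹_l(H) ≥ 2`, `l ≠ p` … `δ¹_l(Π) ≥ 2` implies `l ∈ Σ`"), whose proof uses the
  pro-`Σ` binder ONLY through the off-`Σ` identity "`δ¹_l(J) = δ¹_l(G_J)`, `l ∉ Σ`": restated over that
  identity as an explicit hypothesis (proof verbatim after `AbsTopIThm26iiiRankExcessPrep.lean`, one call
  replaced), hence over `IsAlmostPro` by `freeProlRank_eq_aug_map_of_isAlmostPro`; with the clause-two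
  consequences `MLFBase.subset_thetaSet_two_of_hook_of_isAlmostPro` and
  `subset_thetaSet_two_of_lem27iiiStep_of_isAlmostPro` ("`|θ¹(H)| ≥ 2 ⇒ Σ ⊆ θ²(H)`" from the Lemma 2.7 (iii)
  hook / from abc-iut-w6-d073's `Lem27iiiStep`, for `Δ` ALMOST pro-`Σ`).  The packaged `E.Thm26iii S` over
  `IsAlmostPro` must wait for clause ONE (`θ²(Π) ⊆ Σ`), whose landed `ℤ/lⁱ` route is keyed on `IsProSet`
  (abc-iut-w6-d071's file 3 «AbsTopIThm26iiiClauseOneAlmostPro»).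

Classical profinite group theory on top of landed files; OUR kernel check; [AbsTopI] is refereed and
undisputed; nothing here bears on [IUTchIII] Cor. 3.12; no side is taken.
-/

noncomputable section

open Topology

namespace Literature.AnabelianGeometry.AbsoluteAnabelian

namespace FundamentalExtension

universe u

/-- **[AbsTopI] Thm 2.6 (i) AS TYPED, for `Δ` ALMOST pro-`Σ`.**  For every extension
`1 → Δ → Π → G → 1` of profinite groups, GIVEN (a) `G ≅ Ẑ` (`IsFreeProcyclic E.gal`; print: `k` an FF),
(b) `Δ` topologically finitely generated (Prop 2.2, `E.GeomTFG`), (c) `Δ` ALMOST pro-`Σ` (Def 2.1 (i),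
`IsAlmostPro E.geom S`) and (d) the group-theoretic content of "`T_l(A)/G = 0`" at the primes `l ∈ Σ` only —
for every open `H ⊆ Π` and `l ∈ Σ`, every `H`-invariant continuous character `Δ ∩ H → ℤ_l` is trivial —,
the predicate `E.Thm26i` holds.  For `l ∉ Σ` those characters are trivial because `Δ ∩ H` is almost
pro-`Σ` ((M3) `isAlmostPro_geom_inf_of_isOpen`, (M1) `IsAlmostPro.apply_padicInt_eq_one`).
[cite: MochizukiAbsTopI2012, Thm 2.6 (i) p.21] -/
theorem thm26i_of_isFreeProcyclic_of_isAlmostPro (E : FundamentalExtension.{u})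
    (hG : IsFreeProcyclic E.gal) (S : Set ℕ) (hpro : IsAlmostPro E.geom S) (hΔ : E.GeomTFG)
    (hT : ∀ (H : Subgroup E.arith), IsOpen (H : Set E.arith) → ∀ (l : ℕ) [Fact l.Prime], l ∈ S →
      ∀ (ψ : ↥(E.geom ⊓ H) →ₜ* Multiplicative ℤ_[l]),
      (∀ g ∈ H, ∀ (d d' : ↥(E.geom ⊓ H)), (d' : E.arith) = g * d * g⁻¹ → ψ d' = ψ d) →
        ∀ d, ψ d = 1) :
    E.Thm26i := by
  refine E.thm26i_of_isFreeProcyclic hG hΔ fun H hH l _ ψ hψ d => ?_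
  by_cases hl : l ∈ S
  · exact hT H hH l hl ψ hψ d
  · haveI : CompactSpace ↥(E.geom ⊓ H) :=
      isCompact_iff_compactSpace.mp (E.isClosed_geom.inter (H.isClosed_of_isOpen hH)).isCompact
    exact (E.isAlmostPro_geom_inf_of_isOpen hpro H hH).apply_padicInt_eq_one hl ψ d

/-- **[AbsTopI] Thm 2.6 (ii) AS TYPED, (∗)-route, for `Δ` ALMOST pro-`Σ`.**  For every extension
`1 → Δ → Π → G → 1` with MLF base data `G ≅ G_k`, GIVEN (a) `Δ` topologically finitely generated (Prop 2.2,
`E.GeomTFG`), (b) `G` topologically finitely generated ([NSW] Thm 7.5.10, hypothesis), (c) `Δ` ALMOST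
pro-`Σ` (`IsAlmostPro E.geom S`), (d) a splitting over an open subgroup of `G` ("a rational point of `A`
over some finite extension of `k`", `E.SplitsOverOpenSubgroup`) and (e) condition (∗) of [AbsAnab] Lemma
1.1.4 (ii) (`E.StarCondition`), the predicate `E.Thm26ii B S` holds — the rank identity
"`δ¹_l(Π) = δ¹_l(G) + m`" from (d)+(e) (`exists_freeProlRank_arith_eq_gal_add`), everything else from
`thm26ii_of_isAlmostPro_of_rank`.  HONEST SCOPE: for `Σ ≠ 𝔓𝔯𝔦𝔪𝔢𝔰`, (c)+(e) force `m = 0` (as for the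
pro-`Σ` sibling `thm26ii_of_starCondition_of_isProSet`). [cite: MochizukiAbsTopI2012, Thm 2.6 (ii) p.21] -/
theorem thm26ii_of_starCondition_of_isAlmostPro {E : FundamentalExtension.{0}} (B : E.MLFBase)
    (S : Set ℕ) (hΔ : E.GeomTFG) (hG : IsTopologicallyFinitelyGenerated E.gal)
    (hpro : IsAlmostPro E.geom S) (hs : E.SplitsOverOpenSubgroup) (hstar : E.StarCondition) :
    E.Thm26ii B S := by
  refine thm26ii_of_isAlmostPro_of_rank B S
    (IsTopologicallyFinitelyGenerated.of_extension E.aug E.aug_surjective hΔ hG) hpro ?_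
  obtain ⟨m, hm⟩ := E.exists_freeProlRank_arith_eq_gal_add hs hstar
  exact ⟨m, fun l _ _ => hm l⟩

/-- **[AbsTopI] Thm 2.6 (ii) AS TYPED, (∗)-route, for `Δ` ALMOST pro-`Σ`, with "`G` topologically finitely
generated" supplied by Tate's local Euler–Poincaré characteristic**
(`MLFBase.isTopologicallyFinitelyGenerated_gal_of_localEPC`): GIVEN Prop 2.2, the local Euler–Poincaré
characteristic, `Δ` almost pro-`Σ`, the splitting and (∗). [cite: MochizukiAbsTopI2012, Thm 2.6 (ii) p.21] -/
theorem thm26ii_of_starCondition_of_isAlmostPro_of_localEPC {E : FundamentalExtension.{0}}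
    (B : E.MLFBase) (S : Set ℕ) (hΔ : E.GeomTFG)
    (hEP : ∀ (F : Type) [Field F] [ValuativeRel F] [TopologicalSpace F]
      [IsNonarchimedeanLocalField F] [CharZero F],
      Literature.NumberTheory.GaloisRepresentations.localEulerPoincareCharacteristic F)
    (hpro : IsAlmostPro E.geom S) (hs : E.SplitsOverOpenSubgroup) (hstar : E.StarCondition) :
    E.Thm26ii B S :=
  thm26ii_of_starCondition_of_isAlmostPro B S hΔ (B.isTopologicallyFinitelyGenerated_gal_of_localEPC hEP)
    hpro hs hstar

/-! ### Thm 2.6 (iii) clause two: the rank-excess reduction over an off-`Σ` identity / `IsAlmostPro` -/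

/-- **The rank-excess reduction of [AbsTopI] Thm 2.6 (iii), clause two** (proof p. 23 l. 36–41), at every
open `H ⊆ Π` of an extension with MLF base data, GIVEN ONLY the off-`Σ` identity "`δ¹_l(J) = δ¹_l(G_J)` for
every open `J` and every prime `l ∉ Σ`" (hypothesis `hoff`; for `Δ` pro-`Σ` this is
`freeProlRank_eq_map_aug_of_not_mem`, for `Δ` almost pro-`Σ` `freeProlRank_eq_aug_map_of_isAlmostPro`): if
`|θ¹(H)| ≥ 2`, then some open `J ≤ H` and some prime `l ∈ Σ`, `l ≠ p`, have `δ¹_l(J) ≥ 2` while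
`δ¹_l(G_J) = 1`.  Proof verbatim after abc-iut-w6-d034's `MLFBase.exists_open_rankExcess_of_two_le_encard`
with its single pro-`Σ` call replaced by `hoff`. [cite: MochizukiAbsTopI2012, Thm 2.6 (iii) proof p.23] -/
theorem MLFBase.exists_open_rankExcess_of_two_le_encard_of_offSigma {E : FundamentalExtension.{0}}
    (B : E.MLFBase) {S : Set ℕ}
    (hoff : ∀ (J : Subgroup E.arith), IsOpen (J : Set E.arith) → ∀ (l : ℕ) [Fact l.Prime], l ∉ S →
      freeProlRank J l = freeProlRank (J.map E.aug.toMonoidHom) l)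
    (H : Subgroup E.arith) (hH : IsOpen (H : Set E.arith)) (h2 : 2 ≤ (thetaSet H 1).encard) :
    ∃ (J : Subgroup E.arith), IsOpen (J : Set E.arith) ∧ J ≤ H ∧
      ∃ (l : ℕ) (_ : Fact l.Prime), l ∈ S ∧ l ≠ B.p ∧ (2 : ℕ∞) ≤ freeProlRank J l ∧
        freeProlRank (J.map E.aug.toMonoidHom) l = 1 := by
  letI := B.instPrime
  have hHc : IsClosed (H : Set E.arith) := H.isClosed_of_isOpen hH
  haveI : CompactSpace H := isCompact_iff_compactSpace.mp hHc.isCompact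
  -- a prime `l ≠ p` in `θ¹(H)`
  obtain ⟨l, hlθ, hlp⟩ : ∃ l ∈ thetaSet H 1, l ≠ B.p := by
    have h1 : 1 < (thetaSet H 1).encard := lt_of_lt_of_le (by norm_num) h2
    obtain ⟨a, b, ha, hb, hab⟩ := Set.one_lt_encard_iff.mp h1
    by_cases hap : a = B.p
    · exact ⟨b, hb, fun hbp => hab (hap.trans hbp.symm)⟩
    · exact ⟨a, ha, hap⟩
  obtain ⟨hlP, hε⟩ := hlθ
  haveI : Fact l.Prime := ⟨hlP⟩
  -- an open `J₀ ≤ H` with `δ¹_l(J₀) ≥ 2`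
  obtain ⟨J₀, hJ₀, hJ₀2⟩ : ∃ J₀ : Subgroup H, IsOpen (J₀ : Set H) ∧ (2 : ℕ∞) ≤ deltaInv J₀ 1 l := by
    by_contra hcon
    push Not at hcon
    have hle : epsilonInv H 1 l ≤ 1 := by
      unfold epsilonInv
      refine iSup₂_le fun J₀ hJ₀ => ?_
      exact Order.le_of_lt_add_one (by rw [one_add_one_eq_two]; exact hcon J₀ hJ₀)
    have h2' : ((3 - 1 : ℕ) : ℕ∞) ≤ 1 := hε.trans hle
    norm_num at h2'
  -- push `J₀` into `Π`
  have hJo : IsOpen ((J₀.map H.subtype : Subgroup E.arith) : Set E.arith) := by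
    have h1 : ((J₀.map H.subtype : Subgroup E.arith) : Set E.arith) = Subtype.val '' (J₀ : Set H) := by
      rw [Subgroup.coe_map]; rfl
    rw [h1]
    exact hH.isOpenMap_subtype_val _ hJ₀
  have hmemH : ∀ y : (J₀.map H.subtype : Subgroup E.arith), (y : E.arith) ∈ H := fun y => by
    obtain ⟨x, -, hxy⟩ := y.2
    rw [← hxy]
    exact x.2
  have hmemJ : ∀ y : (J₀.map H.subtype : Subgroup E.arith), (⟨(y : E.arith), hmemH y⟩ : H) ∈ J₀ :=
    fun y => by
    obtain ⟨x, hx, hxy⟩ := y.2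
    have hx' : (⟨(y : E.arith), hmemH y⟩ : H) = x := Subtype.ext hxy.symm
    rw [hx']
    exact hx
  let e : J₀ ≃ₜ* (J₀.map H.subtype : Subgroup E.arith) :=
    { toFun := fun x => ⟨(x : H), ⟨x, x.2, rfl⟩⟩
      invFun := fun y => ⟨⟨(y : E.arith), hmemH y⟩, hmemJ y⟩
      left_inv := fun _ => rfl
      right_inv := fun _ => rfl
      map_mul' := fun _ _ => rfl
      continuous_toFun := (continuous_subtype_val.comp continuous_subtype_val).subtype_mk _
      continuous_invFun := (continuous_subtype_val.subtype_mk _).subtype_mk _ }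
  haveI : CompactSpace J₀ :=
    isCompact_iff_compactSpace.mp (J₀.isClosed_of_isOpen hJ₀).isCompact
  have hrank : (2 : ℕ∞) ≤ freeProlRank (J₀.map H.subtype : Subgroup E.arith) l := by
    rw [← freeProlRank_eq_of_continuousMulEquiv e l, ← deltaInv_one_eq_freeProlRank l]
    exact hJ₀2
  -- LCFT: `δ¹_l(G_J) = 1`
  have hG1 : freeProlRank ((J₀.map H.subtype : Subgroup E.arith).map E.aug.toMonoidHom) l = 1 :=
    (freeProlRank_map_aug_of_rank thm26_ii_delta_gal_holds E B _ hJo).1 l hlp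
  -- `l ∈ Σ`: off `Σ` there is no excess
  have hlS : l ∈ S := by
    by_contra hlS
    have h := hoff _ hJo l hlS
    rw [h, hG1] at hrank
    exact absurd hrank (by norm_num)
  exact ⟨J₀.map H.subtype, hJo, fun x hx => hmemH ⟨x, hx⟩, l, ⟨hlP⟩, hlS, hlp, hrank, hG1⟩

/-- **The rank-excess reduction of Thm 2.6 (iii) clause two, for `Δ` ALMOST pro-`Σ`** (twin of
abc-iut-w6-d034's `MLFBase.exists_open_rankExcess_of_two_le_encard`, keyed on `IsAlmostPro`).
[cite: MochizukiAbsTopI2012, Thm 2.6 (iii) proof p.23] -/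
theorem MLFBase.exists_open_rankExcess_of_two_le_encard_of_isAlmostPro {E : FundamentalExtension.{0}}
    (B : E.MLFBase) {S : Set ℕ} (hΔS : IsAlmostPro E.geom S)
    (H : Subgroup E.arith) (hH : IsOpen (H : Set E.arith)) (h2 : 2 ≤ (thetaSet H 1).encard) :
    ∃ (J : Subgroup E.arith), IsOpen (J : Set E.arith) ∧ J ≤ H ∧
      ∃ (l : ℕ) (_ : Fact l.Prime), l ∈ S ∧ l ≠ B.p ∧ (2 : ℕ∞) ≤ freeProlRank J l ∧
        freeProlRank (J.map E.aug.toMonoidHom) l = 1 :=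
  MLFBase.exists_open_rankExcess_of_two_le_encard_of_offSigma B
    (fun J hJ l _ hl => E.freeProlRank_eq_aug_map_of_isAlmostPro S hΔS J hJ l hl) H hH h2

/-- **Clause two of [AbsTopI] Thm 2.6 (iii) at every open `H ⊆ Π`, from the Lemma 2.7 (iii) hook, for
`Δ` ALMOST pro-`Σ`** (twin of abc-iut-w6-d034's `MLFBase.subset_thetaSet_two_of_hook`): if every open
`J ⊆ Π` carrying a rank excess at some `l₀ ∈ Σ` satisfies `{l ∈ Σ | l prime} ⊆ θ²(J)`, then
`|θ¹(H)| ≥ 2 ⇒ {l ∈ Σ | l prime} ⊆ θ²(H)`. [cite: MochizukiAbsTopI2012, Thm 2.6 (iii) proof p.23] -/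
theorem MLFBase.subset_thetaSet_two_of_hook_of_isAlmostPro {E : FundamentalExtension.{0}}
    (B : E.MLFBase) {S : Set ℕ} (hΔS : IsAlmostPro E.geom S)
    (hook : ∀ (J : Subgroup E.arith), IsOpen (J : Set E.arith) →
      (∃ (l₀ : ℕ) (_ : Fact l₀.Prime), l₀ ∈ S ∧
        freeProlRank (J.map E.aug.toMonoidHom) l₀ < freeProlRank J l₀) →
      {l ∈ S | l.Prime} ⊆ thetaSet J 2)
    (H : Subgroup E.arith) (hH : IsOpen (H : Set E.arith)) (h2 : 2 ≤ (thetaSet H 1).encard) :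
    {l ∈ S | l.Prime} ⊆ thetaSet H 2 := by
  obtain ⟨J, hJ, hJH, l, hl, hlS, -, h2J, h1G⟩ :=
    MLFBase.exists_open_rankExcess_of_two_le_encard_of_isAlmostPro B hΔS H hH h2
  have hex : freeProlRank (J.map E.aug.toMonoidHom) l < freeProlRank J l := by
    rw [h1G]
    exact lt_of_lt_of_le (by norm_num) h2J
  exact (hook J hJ ⟨l, hl, hlS, hex⟩).trans (thetaSet_mono_of_isOpen hJ hJH 2)

/-- **[AbsTopI] Thm 2.6 (iii), second clause, inclusion form, for every open `H₀ ⊆ Π`, modulo Lemma 2.7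
(iii), for `Δ` ALMOST pro-`Σ`** (twin of abc-iut-w6-d073's `subset_thetaSet_two_of_lem27iiiStep`): for MLF
base data, `Δ` almost pro-`Σ` and `Lem27iiiStep`, if `|θ¹(H₀)| ≥ 2` then every prime of `Σ` lies in
`θ²(H₀)`.  (Clause ONE, `θ²(Π) ⊆ Σ`, is not available over `IsAlmostPro` yet, so the packaged `E.Thm26iii S`
is not restated here.) [cite: MochizukiAbsTopI2012, Thm 2.6 (iii) p.22] -/
theorem subset_thetaSet_two_of_lem27iiiStep_of_isAlmostPro {E : FundamentalExtension.{0}}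
    (B : E.MLFBase) {S : Set ℕ} (hpro : IsAlmostPro E.geom S) (h27 : E.Lem27iiiStep S)
    {H₀ : Subgroup E.arith} (hH₀ : IsOpen (H₀ : Set E.arith)) (hθ : 2 ≤ (thetaSet ↥H₀ 1).encard) :
    {l ∈ S | l.Prime} ⊆ thetaSet ↥H₀ 2 :=
  MLFBase.subset_thetaSet_two_of_hook_of_isAlmostPro B hpro (subset_thetaSet_two_of_rankExcess h27)
    H₀ hH₀ hθ

end FundamentalExtension

end Literature.AnabelianGeometry.AbsoluteAnabelian

end
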